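import Summits.AtomisticToContinuum.Crystallization.Theorems.ChargedEnergyGapHcpScaleBox
import HarnessLib

/-!
# Charged energy gap — lens-3 g67, «ScaleSummability»: the census sums of (U-f)/(U-h) are genuine sums (summability for periodic words)

Cell `decomp-a2c`, seat lens-3, generation 67, part P-N⁗·f (APPEND over «HcpScaleBox» `…Theorems.ChargedEnergyGapHcpScaleBox`; same namespace, imports it).
ELEMENTARY·PROVED; complete (no placeholders); standard axioms.

WHAT IT DOES.  The census forms `Fcc.FccScaleNumerics` and `Hcp.HcpScaleBox` carry hypotheses `Σ'_t virialTermNN … = 0`, `Σ'_t virialTerm00 … = 0`; for them to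
mean what they say (and not the `tsum` junk value of a non-summable family — the critic's row-1278 caveat on [DOM], discharged there by «RegistryTail») the
families must be summable.  §N5 proves it for EVERY PERIODIC word (which covers `constHagg`, period 1, and `ε·alternatingHagg`, period 2), at every site,
from the tree's `summable_virial` (site-virial summand summable over the punctured point set of ANY periodic configuration) applied to
`barlowPeriodicConfiguration s …` and transported to `ℤ³` through the injective parametrisation `barlowPos` (`summable_subtype_iff_indicator`,
`Summable.comp_injective barlowPos_injective`): ★ `summable_virial_barlowPos` (any two test vectors `u, v`), ★ `summable_virialTermNN_of_periodic`,
★ `summable_virialTerm00_of_periodic`, and the census instances `Fcc.summable_fccVirialNN/00`, `Hcp.summable_virialTermNN_alt/00_alt` (all `ε`, all sites).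
(For arbitrary words the normal family is «RegistryTail»'s `barlowVirialSummable_holds`; the periodic case is all the census needs and is independent of it.)
-/

open scoped Classical
open Literature.MathematicalPhysics.StatisticalMechanics Literature.Geometry.DiscreteGeometry
open Summit.AtomisticToContinuum.Crystallization.Theses.PricedLinkCensus
open Summit.AtomisticToContinuum.Crystallization.Theorems.ChargedEnergyGapNegative

namespace Summit.AtomisticToContinuum.Crystallization.Theorems.ChargedEnergyGapChartDial

/-! ## §N5 Summability of the two site-virial families for PERIODIC words (so the `= 0` hypotheses of the census forms are genuine, not `tsum` junk) -/

section Summability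

/-- Transport of the tree's `summable_virial` (site-virial summand summable over the punctured point set of ANY periodic configuration) to the
`ℤ³` index set of a Barlow stacking with a PERIODIC word (period `p`), through `barlowPeriodicConfiguration` and the injective parametrisation `barlowPos`. -/
theorem summable_virial_barlowPos {a h : ℝ} (ha : 0 < a) (hh : 0 < h) {s : ℤ → ℤ} {p : ℕ} (hp : p ≠ 0) (hs : ∀ i, s (i + p) = s i)
    (m i₀ j₀ : ℤ) (u v : E3) :
    Summable fun t : ℤ × ℤ × ℤ =>
      ljD1 (dist (barlowPos a h s m i₀ j₀) (barlowPos a h s t.1 t.2.1 t.2.2)) / dist (barlowPos a h s m i₀ j₀) (barlowPos a h s t.1 t.2.1 t.2.2) *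
        (inner ℝ (barlowPos a h s t.1 t.2.1 t.2.2 - barlowPos a h s m i₀ j₀) u * inner ℝ (barlowPos a h s t.1 t.2.1 t.2.2 - barlowPos a h s m i₀ j₀) v) := by
  set y := barlowPos a h s m i₀ j₀ with hy
  set P₀ := barlowPeriodicConfiguration s ha.ne' hh.ne' hp hs with hP₀
  have hpts : P₀.points = barlowStacking a h s := barlowPeriodicConfiguration_points s ha.ne' hh.ne' hp hs
  set F : E3 → ℝ := fun w => ljD1 (dist y w) / dist y w * (inner ℝ (w - y) u * inner ℝ (w - y) v) with hF
  have hS0 := summable_virial P₀ y u v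
  let e : {z : E3 // z ∈ P₀.points ∧ z ≠ y} ≃ {w : E3 // w ∈ barlowStacking a h s ∧ w ≠ y} :=
    Equiv.subtypeEquivRight fun z => by rw [hpts]
  have hS : Summable fun w : {w : E3 // w ∈ barlowStacking a h s ∧ w ≠ y} => F w :=
    (e.summable_iff (f := fun w : {w : E3 // w ∈ barlowStacking a h s ∧ w ≠ y} => F w)).1 hS0
  -- transfer `S ∖ {y} → ℤ³` through the injective parametrisation `barlowPos` (as in «RegistryTail» §V5, inlined)
  have h1 : Summable ({w : E3 | w ∈ barlowStacking a h s ∧ w ≠ y}.indicator F) :=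
    (summable_subtype_iff_indicator (s := {w : E3 | w ∈ barlowStacking a h s ∧ w ≠ y})).1 hS
  refine (h1.comp_injective (barlowPos_injective ha hh s)).congr fun t => ?_
  simp only [Function.comp]
  by_cases ht : barlowPos a h s t.1 t.2.1 t.2.2 = y
  · rw [ht, Set.indicator_of_notMem (by simp)]
    simp
  · exact Set.indicator_of_mem (show barlowPos a h s t.1 t.2.1 t.2.2 ∈ {w : E3 | w ∈ barlowStacking a h s ∧ w ≠ y} from
      ⟨barlowPos_mem t.1 t.2.1 t.2.2, ht⟩) F

/-- ★ The normal–normal family `virialTermNN a h s m i₀ j₀` is summable for every PERIODIC word (all `a, h > 0`).  (For every word this is «RegistryTail»'s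
`barlowVirialSummable_holds`; the periodic case is all the census forms need and is immediate from `summable_virial`.) -/
theorem summable_virialTermNN_of_periodic {a h : ℝ} (ha : 0 < a) (hh : 0 < h) {s : ℤ → ℤ} {p : ℕ} (hp : p ≠ 0) (hs : ∀ i, s (i + p) = s i)
    (m i₀ j₀ : ℤ) : Summable (virialTermNN a h s m i₀ j₀) := by
  refine (summable_virial_barlowPos ha hh hp hs m i₀ j₀ (layerNormal 1) (layerNormal 1)).congr fun t => ?_
  simp only [virialTermNN, inner_layerNormal_one, PiLp.sub_apply, barlowPos_apply_two, dist_eq_norm', sub_mul]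

/-- ★ The in-plane family `virialTerm00 a h s m i₀ j₀` is summable for every PERIODIC word (all `a, h > 0`). -/
theorem summable_virialTerm00_of_periodic {a h : ℝ} (ha : 0 < a) (hh : 0 < h) {s : ℤ → ℤ} {p : ℕ} (hp : p ≠ 0) (hs : ∀ i, s (i + p) = s i)
    (m i₀ j₀ : ℤ) : Summable (virialTerm00 a h s m i₀ j₀) := by
  refine (summable_virial_barlowPos ha hh hp hs m i₀ j₀ (EuclideanSpace.single (0 : Fin 3) (1 : ℝ)) (EuclideanSpace.single (0 : Fin 3) (1 : ℝ))).congr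
    fun t => ?_
  simp only [virialTerm00, inner_single_zero, dist_eq_norm']

/-- fcc: both census sums are genuine sums (`constHagg` has period `1`). -/
theorem Fcc.summable_fccVirialNN {a h : ℝ} (ha : 0 < a) (hh : 0 < h) : Summable (virialTermNN a h constHagg 0 0 0) :=
  summable_virialTermNN_of_periodic ha hh one_ne_zero (fun _ => rfl) 0 0 0

/-- `Fcc.summable_fccVirial00` (docstring added by the landing lane; see the module docstring). [formal bookkeeping] -/
theorem Fcc.summable_fccVirial00 {a h : ℝ} (ha : 0 < a) (hh : 0 < h) : Summable (virialTerm00 a h constHagg 0 0 0) :=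
  summable_virialTerm00_of_periodic ha hh one_ne_zero (fun _ => rfl) 0 0 0

/-- The words `ε·alternatingHagg` have period `2`. -/
theorem smul_alternatingHagg_periodic (ε : ℤ) (i : ℤ) : (fun i => ε * alternatingHagg i) (i + 2) = (fun i => ε * alternatingHagg i) i := by
  simp only [alternatingHagg_periodic]

/-- hcp class: all four census sums are genuine sums (`ε·alternatingHagg` has period `2`), at every site. -/
theorem Hcp.summable_virialTermNN_alt {a h : ℝ} (ha : 0 < a) (hh : 0 < h) (ε m i₀ j₀ : ℤ) :
    Summable (virialTermNN a h (fun i => ε * alternatingHagg i) m i₀ j₀) :=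
  summable_virialTermNN_of_periodic ha hh two_ne_zero (smul_alternatingHagg_periodic ε) m i₀ j₀

/-- `Hcp.summable_virialTerm00_alt` (docstring added by the landing lane; see the module docstring). [formal bookkeeping] -/
theorem Hcp.summable_virialTerm00_alt {a h : ℝ} (ha : 0 < a) (hh : 0 < h) (ε m i₀ j₀ : ℤ) :
    Summable (virialTerm00 a h (fun i => ε * alternatingHagg i) m i₀ j₀) :=
  summable_virialTerm00_of_periodic ha hh two_ne_zero (smul_alternatingHagg_periodic ε) m i₀ j₀

end Summability

end Summit.AtomisticToContinuum.Crystallization.Theorems.ChargedEnergyGapChartDial
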